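import Mathlib
import Summits.ResolutionOfSingularities.ResolutionOfSingularities.Theorems.WeightedInvariantLocalWeightedDropNCPolyBridgePointMove
import Summits.ResolutionOfSingularities.ResolutionOfSingularities.Theorems.WeightedInvariantLocalWeightedDropMonicCurveBlowup

/-!
# `WeightedInvariant.LocalWeightedDrop`, TOT2-LINE piece S-E2′ (the count-game bridge), part 2: THE CURVE MOVES — blowing up a permissible
# coordinate curve `V(y, u_i)` of a represented position, every successor is a normal crossing or represents `A / u_i^{d−·}`

Crux item stmt-ResolutionOfSingularities-8899 `LocalWeightedDrop` (route `ResolutionOfSingularities/WeightedInvariant`), ENGINE skeleton v32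
(ddb48572591139d5), registered stub `stub_spaceNCRankDrop`; TOT2-LINE v1.1 §(E) piece S-E2′ (`L/res-L1-w43-lead-1/g4/TOT2-LINE.md`).
[OURS · L1 W4.3 · chain w43 · lead-1 gen 4.  Port of the curve half of the weighted-game bridge (ρ-B) of the line «monic polyhedron descent»
(res-D-pv-058 AS stub-6 / res-type-061: …PolyDescentBridgeSlices `curveSlice_zero_eq'`/`curveSlice_one_eq'`; stub worker 3's brick
…MonicCurveBlowup `transform_curve`/`slice_g₀`/`not_X_dvd_g₀`) to the successors of the NC count game (`TameFourTupleDrop.MoveClause`, res-type-056).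
MODEL: Cossart–Jannsen–Saito LNM 2270 §11 Case 2 / §13 (blow-up of a permissible curve through the point, near points over it); Perlega
arXiv:2011.14443 §7.2.  Nothing here is a statement of any manuscript; the games are the programme's own.  AI-produced, gate-checked, weaker than
expert review.]

* `chart_eq_cruxChart` — under the move clause's convention the clause's chart `CobordantChart.chart w c` is the crux chart `cruxChart k w c`;
* `subst_cruxChart_curve_bdry` — the boundary under the curve chart: `bdry N ↦ [s]_{i ∈ N} · planes N c`;
* `gCurve`, `gCoef`, **`curve_factorisation`** — the `s`-saturation of the transform of a represented `V(y,u_i)`-permissible position at an exceptional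
  point is `(U ∘ chart) · gCurve · planes` (`MonicCurveBlowup.transform_curve`);
* `represents_curveSucc_zero` / `represents_curveSucc_one` — at `γ = 0` the successor at the slot `u_i` represents `A′` with boundary
  `{u_i} ∪ (N ∖ {u_i})` (via the transfer lemma `represents_of_sliceData` of part 1c and the slice identifications `PolyDescent.curveSlice_*_eq'`);
* **`curveMoveZero_of_represents`**, **`curveMoveOne_of_represents`** — THE CURVE MOVES: if `b` represents a positive label `A` with `A_j = u_i^{d−j} A′_j`
  (`PolyDescent.IsPermissibleOneT/TwoT` unfolded by `PolyDescent.eq_X_pow_mul_divOneT/divTwoT`), then the blow-up of `V(y,u_i)` (weights `1` at `u_i`, `y`;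
  the representing coordinates as `Φ`) is a legal count move whose successors are unit × monomial (off `γ = 0`) or represent `A′` — the labels
  `divOneT d A` / `divTwoT d A` of `PolyDescent.succT`'s curve branches.
-/

set_option linter.dupNamespace false -- mandated namespace of this single-conjunct summit

noncomputable section

namespace Summit.ResolutionOfSingularities.ResolutionOfSingularities.Theorems

namespace NCPoly

open MvPowerSeries Literature.AlgebraicGeometry.Resolution TameFourTupleDrop

variable {k : Type} [Field k]

/-! ## The weights and charts of the curve blow-ups `V(y, u_i)` -/

/-- Off the blown-up plane letter the curve weights vanish. -/
theorem curveWt_castSucc_ne {i l : Fin 2} (h : l ≠ i) :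
    (fun l : Fin (2 + 1) => if l = Fin.castSucc i ∨ l = Fin.last 2 then (1 : ℕ) else 0) (Fin.castSucc l) = 0 :=
  if_neg (not_or.mpr ⟨fun e => h (Fin.castSucc_injective _ e), (Fin.castSucc_lt_last l).ne⟩)

/-- The curve weights are at most `1`. -/
theorem curveWt_le_one (i : Fin 2) (l : Fin 3) :
    (fun l : Fin (2 + 1) => if l = Fin.castSucc i ∨ l = Fin.last 2 then (1 : ℕ) else 0) l ≤ 1 := by
  dsimp only; split_ifs <;> simp

/-- Under the move clause's convention (`c_l = 0` where the weight vanishes) the chart of the clause is the crux chart. -/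
theorem chart_eq_cruxChart {n : ℕ} (w : Fin n → ℕ) (c : Fin n → k) (hc : ∀ i, w i = 0 → c i = 0) :
    CobordantChart.chart w c = CobordantGame.cruxChart k w c := by
  funext i
  rw [CobordantChart.chart_apply]
  unfold CobordantGame.cruxChart
  by_cases h : 0 < w i
  · rw [if_pos h]
  · have h0 : w i = 0 := Nat.eq_zero_of_not_pos h
    rw [if_neg h, h0, pow_zero, one_mul, hc i h0, map_zero, zero_add]

/-- The crux chart of the curve weights on the blown-up plane letter: `u_i ↦ s · (c_i + y′_i)`. -/
theorem cruxChart_curve_self (i : Fin 2) (c : Fin 3 → k) :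
    CobordantGame.cruxChart k (fun l : Fin (2 + 1) => if l = Fin.castSucc i ∨ l = Fin.last 2 then (1 : ℕ) else 0) c (Fin.castSucc i) =
      X 0 * (C (c (Fin.castSucc i)) + X (Fin.castSucc i).succ) := by
  unfold CobordantGame.cruxChart
  simp

/-- The crux chart of the curve weights on the other plane letter: `u_l ↦ y′_l`. -/
theorem cruxChart_curve_ne {i l : Fin 2} (h : l ≠ i) (c : Fin 3 → k) :
    CobordantGame.cruxChart k (fun l : Fin (2 + 1) => if l = Fin.castSucc i ∨ l = Fin.last 2 then (1 : ℕ) else 0) c (Fin.castSucc l) =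
      X (Fin.castSucc l).succ := by
  unfold CobordantGame.cruxChart
  rw [curveWt_castSucc_ne h, if_neg (lt_irrefl 0)]

/-- The boundary under the curve chart: `bdry N ↦ [s]_{i ∈ N} · planes N c` (convention `c_l = 0` for `l ≠ i`). -/
theorem subst_cruxChart_curve_bdry (i : Fin 2) (c : Fin 3 → k) (hc : ∀ l : Fin 2, l ≠ i → c (Fin.castSucc l) = 0)
    (N : Finset (Fin 2)) :
    subst (CobordantGame.cruxChart k (fun l : Fin (2 + 1) => if l = Fin.castSucc i ∨ l = Fin.last 2 then (1 : ℕ) else 0) c)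
        (bdry N : MvPowerSeries (Fin 3) k) = (if i ∈ N then X 0 else 1) * planes N c := by
  classical
  have hs := hasSubst_of_constantCoeff_zero (constantCoeff_cruxChart (k := k)
    (fun l : Fin (2 + 1) => if l = Fin.castSucc i ∨ l = Fin.last 2 then (1 : ℕ) else 0) c)
  unfold bdry planes
  rw [← coe_substAlgHom hs, map_prod, ← Finset.prod_ite_eq' N i (fun _ => (X 0 : MvPowerSeries (Fin 4) k)),
    ← Finset.prod_mul_distrib]
  refine Finset.prod_congr rfl fun l _ => ?_
  rw [coe_substAlgHom, subst_X hs]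
  by_cases hl : l = i
  · rw [if_pos hl, hl, cruxChart_curve_self]
  · rw [if_neg hl, cruxChart_curve_ne hl, hc l hl, map_zero, zero_add, one_mul]

/-! ## The strict transform under a curve blow-up -/

/-- The strict transform `g = (γ + y′)^d + Σ_j (c_i + y′_i)^{d−j} · G_j · (γ + y′)^j` of a `V(y,u_i)`-permissible monic germ at the exceptional point
`(c, γ)` (the shape of `MonicCurveBlowup.transform_curve` at `m = 2`; `G_j = A′_j ∘ chart′`). -/
def gCurve (d : ℕ) (i : Fin 2) (γ ci : k) (G : Fin d → MvPowerSeries (Fin 3) k) : MvPowerSeries (Fin 4) k :=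
  (C γ + X (Fin.last 3)) ^ d + ∑ j : Fin d, (C ci + X (Fin.castSucc i).succ) ^ (d - (j : ℕ)) *
    rename (Fin.succAboveEmb (Fin.last 3)) (G j) * (C γ + X (Fin.last 3)) ^ (j : ℕ)

/-- The plane part of the transform: `G_j = A′_j ∘ chart_{e_i}(c′)`. -/
def gCoef (i : Fin 2) (c : Fin 3 → k) {d : ℕ} (A' : Fin d → MvPowerSeries (Fin 2) k) : Fin d → MvPowerSeries (Fin 3) k :=
  fun j => subst (CobordantGame.cruxChart k (fun l : Fin 2 => if l = i then (1 : ℕ) else 0) (fun l => c (Fin.castSucc l))) (A' j)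

/-- `G_j(0) = A′_j(0)`. -/
theorem constantCoeff_gCoef (i : Fin 2) (c : Fin 3 → k) {d : ℕ} (A' : Fin d → MvPowerSeries (Fin 2) k) (j : Fin d) :
    constantCoeff (gCoef i c A' j) = constantCoeff (A' j) :=
  constantCoeff_subst_of_constantCoeff_zero _ (constantCoeff_cruxChart (k := k) _ _) _

/-- **THE CURVE CHART FACTORISATION.**  If `b ∘ Θ = U · monicGerm A · bdry N` with `A_j = u_i^{d−j} A′_j`, then at an exceptional point `c` of the
blow-up of `V(y, u_i)` (`c_l = 0` off the letters `u_i`, `y`) any `s`-saturation `s^A · G`, `s ∤ G`, of the transform has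
`G = (U ∘ chart) · gCurve · planes`. -/
theorem curve_factorisation {d : ℕ} {A A' : Fin d → MvPowerSeries (Fin 2) k} (i : Fin 2) (hperm : ∀ j, A j = X i ^ (d - (j : ℕ)) * A' j)
    {b U : MvPowerSeries (Fin 3) k} {Θ : Fin 3 → MvPowerSeries (Fin 3) k} {N : Finset (Fin 2)}
    (hU : constantCoeff U ≠ 0) (hb : subst Θ b = U * monicGerm d A * bdry N) (c : Fin 3 → k)
    (hc : ∀ l : Fin 2, l ≠ i → c (Fin.castSucc l) = 0) {Aexp : ℕ} {G : MvPowerSeries (Fin 4) k}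
    (hfac : subst (CobordantGame.cruxChart k (fun l : Fin (2 + 1) => if l = Fin.castSucc i ∨ l = Fin.last 2 then (1 : ℕ) else 0) c)
      (subst Θ b) = X 0 ^ Aexp * G) (hG : ¬ X (0 : Fin 4) ∣ G) :
    G = subst (CobordantGame.cruxChart k (fun l : Fin (2 + 1) => if l = Fin.castSucc i ∨ l = Fin.last 2 then (1 : ℕ) else 0) c) U *
      gCurve d i (c (Fin.last 2)) (c (Fin.castSucc i)) (gCoef i c A') * planes N c := by
  classical
  set Wt : Fin (2 + 1) → ℕ := fun l => if l = Fin.castSucc i ∨ l = Fin.last 2 then (1 : ℕ) else 0 with hWt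
  have hch0 := constantCoeff_cruxChart (k := k) Wt c
  have hch := hasSubst_of_constantCoeff_zero hch0
  have hT : subst (CobordantGame.cruxChart k Wt c) (monicGerm d A) =
      X 0 ^ d * gCurve d i (c (Fin.last 2)) (c (Fin.castSucc i)) (gCoef i c A') := by
    rw [monicGerm, hWt, MonicCurveBlowup.transform_curve i A A' hperm c]
    rfl
  have hlhs : subst (CobordantGame.cruxChart k Wt c) (subst Θ b) = X 0 ^ (d + (if i ∈ N then 1 else 0)) *
      (subst (CobordantGame.cruxChart k Wt c) U * gCurve d i (c (Fin.last 2)) (c (Fin.castSucc i)) (gCoef i c A') * planes N c) := by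
    rw [hb, ← coe_substAlgHom hch, map_mul, map_mul, coe_substAlgHom, hT, hWt, subst_cruxChart_curve_bdry i c hc]
    split_ifs
    · rw [pow_succ]; ring
    · rw [add_zero]; ring
  have hne : ¬ X (0 : Fin 4) ∣ subst (CobordantGame.cruxChart k Wt c) U *
      gCurve d i (c (Fin.last 2)) (c (Fin.castSucc i)) (gCoef i c A') * planes N c := by
    have hp := MvPowerSeries.prime_X' k (0 : Fin 4)
    intro h
    rcases hp.dvd_or_dvd h with h | h
    · rcases hp.dvd_or_dvd h with h | h
      · exact not_X_dvd_of_constantCoeff_ne_zero (by rw [constantCoeff_subst_of_constantCoeff_zero _ hch0]; exact hU) h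
      · exact MonicCurveBlowup.not_X_dvd_g₀ (m := 2) i _ _ _ h
    · exact not_X_dvd_planes _ _ h
  rw [hlhs] at hfac
  exact (X_pow_mul_eq_X_pow_mul 0 hfac hne hG).2.symm

/-- The crux chart of the plane weights `e_i` reads only `c_i`: it is the cobordant chart at the point `c_i e_i`. -/
theorem cruxChart_plane_eq (i : Fin 2) (c' : Fin 2 → k) (a : k) (ha : c' i = a) :
    CobordantGame.cruxChart k (fun l : Fin 2 => if l = i then (1 : ℕ) else 0) c' =
      CobordantChart.chart (fun l : Fin 2 => if l = i then 1 else 0) (fun l : Fin 2 => if l = i then a else 0) := by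
  rw [chart_eq_cruxChart _ _ (fun l hl => by simp_all)]
  funext l
  unfold CobordantGame.cruxChart
  by_cases hl : l = i
  · subst hl; simp [ha]
  · simp [hl]

/-! ## THE CURVE SUCCESSORS REPRESENT `A′ = A / u_i^{d−·}` -/

/-- Slot `u₁` of the blow-up of `V(y,u₁)` (`γ = 0`, `c₀ ≠ 0`): the successor represents `A′` with boundary `{u₁} ∪ {u₂ : u₂ ∈ N}`. -/
theorem represents_curveSucc_zero {d : ℕ} (A' : Fin d → MvPowerSeries (Fin 2) k) (N : Finset (Fin 2)) (c : Fin 3 → k)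
    (hc0 : c 0 ≠ 0) (hc1 : c 1 = 0) {V : MvPowerSeries (Fin 4) k} (hV : constantCoeff V ≠ 0) :
    Represents (X 0 * TupleGame.slice (0 : Fin 3) (V * gCurve d 0 0 (c 0) (gCoef 0 c A') * planes N c)) d A'
      (insert 0 (N.filter fun l => l = 1)) := by
  classical
  set τ : Fin 2 → MvPowerSeries (Fin 2) k := PlaneGerm.diagScale (c 0)⁻¹ 1 with hτ
  have hτ0 : ∀ i, constantCoeff (τ i) = 0 := PlaneGerm.constantCoeff_diagScale _ _
  have hτs := hasSubst_of_constantCoeff_zero hτ0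
  have hτ_apply0 : τ 0 = C (c 0)⁻¹ * X 0 := by simp [hτ, PlaneGerm.diagScale]
  have hτ_apply1 : τ 1 = C 1 * X 1 := by simp [hτ, PlaneGerm.diagScale]
  have hsg : TupleGame.slice (0 : Fin 3) (gCurve d 0 0 (c 0) (gCoef 0 c A')) =
      monicGerm d (fun j => C (c 0 ^ (d - (j : ℕ))) * TupleGame.slice (0 : Fin 2) (gCoef 0 c A' j)) :=
    MonicCurveBlowup.slice_g₀ (m := 2) 0 (c 0) (gCoef 0 c A')
  rw [slice_mul, slice_mul, hsg, slice_zero_planes, hc1, map_zero, zero_add]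
  refine represents_of_sliceData _ _ hc0 (PlaneGerm.diagScale (c 0) 1) τ (PlaneGerm.constantCoeff_diagScale _ _) hτ0
    (by rw [hτ, WildPurePower.linMat_diagScale_det, mul_one]; exact isUnit_iff_ne_zero.mpr (inv_ne_zero hc0))
    (fun s => ?_) (fun j => ?_) (by rw [TupleMonomialPhase.constantCoeff_slice]; exact hV)
    (Q := C (c 0)⁻¹ * (if (0 : Fin 2) ∈ N then C (c 0) else 1)) ?_ _ ?_
  · fin_cases s
    · show subst τ (PlaneGerm.diagScale (c 0) 1 0) = X 0
      have h0 : PlaneGerm.diagScale (c 0) (1 : k) 0 = C (c 0) * X 0 := by simp [PlaneGerm.diagScale]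
      rw [h0, PolyDescent.subst_C_mul_of_constantCoeff_zero τ hτ0, subst_X hτs, hτ_apply0, ← mul_assoc, ← map_mul,
        mul_inv_cancel₀ hc0, map_one, one_mul]
    · show subst τ (PlaneGerm.diagScale (c 0) 1 1) = X 1
      have h1 : PlaneGerm.diagScale (c 0) (1 : k) 1 = C 1 * X 1 := by simp [PlaneGerm.diagScale]
      rw [h1, PolyDescent.subst_C_mul_of_constantCoeff_zero τ hτ0, subst_X hτs, hτ_apply1, map_one, one_mul, one_mul]
  · -- the coefficient identification (…PolyDescentBridgeSlices)
    have hce : (fun l : Fin 2 => c (Fin.castSucc l)) 0 = c 0 := rfl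
    have h := PolyDescent.curveSlice_zero_eq' (c 0) A' j
    rw [PolyDescent.diagFamily_eq_diagScale, ← cruxChart_plane_eq 0 (fun l => c (Fin.castSucc l)) (c 0) hce] at h
    exact h
  · rw [map_mul, constantCoeff_C]
    refine mul_ne_zero (inv_ne_zero hc0) ?_
    split_ifs
    · rw [constantCoeff_C]; exact hc0
    · rw [constantCoeff_one]; exact one_ne_zero
  · have himX0 := image_X (γ₁ := c 0) hτ0 hτ_apply0
    have himX1 := image_X (γ₁ := c 0) hτ0 hτ_apply1
    have himC := image_C (c 0) τ
    simp only [Fin.castSucc_zero, Fin.castSucc_one] at himX0 himX1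
    have hbd : (bdry (insert 0 (N.filter fun l => l = 1)) : MvPowerSeries (Fin 3) k) =
        X 0 * (if (1 : Fin 2) ∈ N then X 1 else 1) := by
      rw [bdry_eq]
      simp [Finset.mem_insert, Finset.mem_filter]
    have hΘ₁s := hasSubst_of_constantCoeff_zero (constantCoeff_extendLast' τ hτ0)
    have hΨs := hasSubst_of_constantCoeff_zero (constantCoeff_yScale (k := k) (c 0))
    rw [hbd]
    by_cases h0N : (0 : Fin 2) ∈ N <;> by_cases h1N : (1 : Fin 2) ∈ N <;>
      simp only [h0N, h1N, ↓reduceIte] <;>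
      rw [← coe_substAlgHom hΘ₁s, ← coe_substAlgHom hΨs] <;>
      simp only [map_mul, map_one] <;>
      simp only [coe_substAlgHom, himX0, himX1, himC, map_one, one_mul] <;>
      ring

/-- Slot `u₂` of the blow-up of `V(y,u₂)` (`γ = 0`, `c₁ ≠ 0`): the successor represents `A′` with boundary `{u₂} ∪ {u₁ : u₁ ∈ N}`. -/
theorem represents_curveSucc_one {d : ℕ} (A' : Fin d → MvPowerSeries (Fin 2) k) (N : Finset (Fin 2)) (c : Fin 3 → k)
    (hc0 : c 0 = 0) (hc1 : c 1 ≠ 0) {V : MvPowerSeries (Fin 4) k} (hV : constantCoeff V ≠ 0) :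
    Represents (X 0 * TupleGame.slice (1 : Fin 3) (V * gCurve d 1 0 (c 1) (gCoef 1 c A') * planes N c)) d A'
      (insert 1 (N.filter fun l => l = 0)) := by
  classical
  set σ : Fin 2 → MvPowerSeries (Fin 2) k :=
    fun l => if l = 0 then C 1 * X 1 else C (c 1) * (X 0 : MvPowerSeries (Fin 2) k) with hσ
  set τ : Fin 2 → MvPowerSeries (Fin 2) k :=
    fun l => if l = 0 then C (c 1)⁻¹ * X 1 else C 1 * (X 0 : MvPowerSeries (Fin 2) k) with hτ
  have hσ0 : ∀ i, constantCoeff (σ i) = 0 := PureDescent.constantCoeff_swapDiag _ _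
  have hτ0 : ∀ i, constantCoeff (τ i) = 0 := PureDescent.constantCoeff_swapDiag _ _
  have hτs := hasSubst_of_constantCoeff_zero hτ0
  have hσ_apply0 : σ 0 = C 1 * X 1 := by simp [hσ]
  have hσ_apply1 : σ 1 = C (c 1) * X 0 := by simp [hσ]
  have hτ_apply0 : τ 0 = C (c 1)⁻¹ * X 1 := by simp [hτ]
  have hτ_apply1 : τ 1 = C 1 * X 0 := by simp [hτ]
  have hsg : TupleGame.slice (1 : Fin 3) (gCurve d 1 0 (c 1) (gCoef 1 c A')) =
      monicGerm d (fun j => C (c 1 ^ (d - (j : ℕ))) * TupleGame.slice (1 : Fin 2) (gCoef 1 c A' j)) :=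
    MonicCurveBlowup.slice_g₀ (m := 2) 1 (c 1) (gCoef 1 c A')
  rw [slice_mul, slice_mul, hsg, slice_one_planes, hc0, map_zero, zero_add]
  refine represents_of_sliceData _ _ hc1 σ τ hσ0 hτ0
    (by rw [hτ]; exact PureDescent.isUnit_det_swapDiag (inv_ne_zero hc1) one_ne_zero)
    (fun s => ?_) (fun j => ?_) (by rw [TupleMonomialPhase.constantCoeff_slice]; exact hV)
    (Q := C (c 1)⁻¹ * (if (1 : Fin 2) ∈ N then C (c 1) else 1)) ?_ _ ?_
  · fin_cases s
    · show subst τ (σ 0) = X 0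
      rw [hσ_apply0, PolyDescent.subst_C_mul_of_constantCoeff_zero τ hτ0, subst_X hτs, hτ_apply1, map_one, one_mul, one_mul]
    · show subst τ (σ 1) = X 1
      rw [hσ_apply1, PolyDescent.subst_C_mul_of_constantCoeff_zero τ hτ0, subst_X hτs, hτ_apply0, ← mul_assoc, ← map_mul,
        mul_inv_cancel₀ hc1, map_one, one_mul]
  · have hce : (fun l : Fin 2 => c (Fin.castSucc l)) 1 = c 1 := rfl
    have h := PolyDescent.curveSlice_one_eq' (c 1) A' j
    rw [← cruxChart_plane_eq 1 (fun l => c (Fin.castSucc l)) (c 1) hce] at h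
    exact h
  · rw [map_mul, constantCoeff_C]
    refine mul_ne_zero (inv_ne_zero hc1) ?_
    split_ifs
    · rw [constantCoeff_C]; exact hc1
    · rw [constantCoeff_one]; exact one_ne_zero
  · have himX0 := image_X (γ₁ := c 1) hτ0 hτ_apply0
    have himX1 := image_X (γ₁ := c 1) hτ0 hτ_apply1
    have himC := image_C (c 1) τ
    simp only [Fin.castSucc_zero, Fin.castSucc_one] at himX0 himX1
    have hbd : (bdry (insert 1 (N.filter fun l => l = 0)) : MvPowerSeries (Fin 3) k) =
        (if (0 : Fin 2) ∈ N then X 0 else 1) * X 1 := by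
      rw [bdry_eq]
      simp [Finset.mem_insert, Finset.mem_filter]
    have hΘ₁s := hasSubst_of_constantCoeff_zero (constantCoeff_extendLast' τ hτ0)
    have hΨs := hasSubst_of_constantCoeff_zero (constantCoeff_yScale (k := k) (c 1))
    rw [hbd]
    by_cases h0N : (0 : Fin 2) ∈ N <;> by_cases h1N : (1 : Fin 2) ∈ N <;>
      simp only [h0N, h1N, ↓reduceIte] <;>
      rw [← coe_substAlgHom hΘ₁s, ← coe_substAlgHom hΨs] <;>
      simp only [map_mul, map_one] <;>
      simp only [coe_substAlgHom, himX0, himX1, himC, map_one, one_mul] <;>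
      ring

/-! ## THE CURVE MOVES -/

/-- A non-zero point with `c_y = 0` and `c_l = 0` (`l ≠ i`) has `c_i ≠ 0`. -/
theorem castSucc_ne_zero_of_curvePoint (i : Fin 2) {c : Fin 3 → k} (hc : c ≠ 0) (hγ : c (Fin.last 2) = 0)
    (hcl : ∀ l : Fin 2, l ≠ i → c (Fin.castSucc l) = 0) : c (Fin.castSucc i) ≠ 0 := fun hci =>
  hc (funext fun l => by
    rcases Fin.eq_self_or_eq_succAbove (Fin.last 2) l with rfl | ⟨j, rfl⟩
    · exact hγ
    · rw [Fin.succAbove_last]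
      by_cases hj : j = i
      · rw [hj]; exact hci
      · exact hcl j hj)

/-- **THE CURVE MOVE `V(y,u₁)` of the count-game bridge.**  If `b` represents `A` with boundary `N` and `V(y,u₁)` is permissible
(`A_j = u₁^{d−j} · A′_j`, `A` positive), then blowing up `V(y,u₁)` — weights `(1,0,1)`, the representing coordinates as the move's `Φ` — is a legal count
move and every successor position is unit × monomial (off `γ = 0`) or represents `A′` with boundary `{u₁} ∪ {u₂ : u₂ ∈ N}`. -/
theorem curveMoveZero_of_represents {d : ℕ} {A A' : Fin d → MvPowerSeries (Fin 2) k} (hA : PolyDescent.IsPosT d A)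
    (hperm : ∀ j, A j = X 0 ^ (d - (j : ℕ)) * A' j) {b : MvPowerSeries (Fin 3) k} {N : Finset (Fin 2)} (hrep : Represents b d A N) :
    ∃ Φ : Fin 3 → MvPowerSeries (Fin 3) k,
      IsCountMove (m := 2) Φ (fun l : Fin (2 + 1) => if l = Fin.castSucc 0 ∨ l = Fin.last 2 then (1 : ℕ) else 0) ∧
      MoveClause (m := 2) b Φ (fun l : Fin (2 + 1) => if l = Fin.castSucc 0 ∨ l = Fin.last 2 then (1 : ℕ) else 0)
        (fun b' => IsStdNC b' ∨ Represents b' d A' (insert 0 (N.filter fun l => l = 1))) := by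
  classical
  obtain ⟨Θ, U, hΘ0, hdet, hU, hb⟩ := hrep
  refine ⟨Θ, ⟨hΘ0, hdet, curveWt_le_one 0, Fin.last 2, by simp⟩, fun c hcv hc Aexp G hfac hG => ?_⟩
  have hcl : ∀ l : Fin 2, l ≠ 0 → c (Fin.castSucc l) = 0 := fun l hl => hcv _ (curveWt_castSucc_ne hl)
  rw [chart_eq_cruxChart _ c hcv] at hfac
  have hGeq := curve_factorisation 0 hperm hU hb c hcl hfac hG
  subst hGeq
  have hUc : constantCoeff (subst (CobordantGame.cruxChart k
      (fun l : Fin (2 + 1) => if l = Fin.castSucc 0 ∨ l = Fin.last 2 then (1 : ℕ) else 0) c) U) ≠ 0 := by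
    rw [constantCoeff_subst_of_constantCoeff_zero _ (constantCoeff_cruxChart (k := k) _ _)]; exact hU
  by_cases hγ : c (Fin.last 2) = 0
  · have hc0 : c 0 ≠ 0 := castSucc_ne_zero_of_curvePoint 0 hc hγ hcl
    refine ⟨0, hc0, Or.inr ?_⟩
    rw [hγ]
    exact represents_curveSucc_zero A' N c hc0 (hcl 1 (by decide)) hUc
  · refine ⟨Fin.last 2, hγ, Or.inl (isStdNC_succ_last N c hUc ?_)⟩
    rw [gCurve, MonicCurveBlowup.constantCoeff_g₀ (m := 2) 0 _ _ _ (fun j => by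
      rw [constantCoeff_gCoef]; exact MonicCurveBlowup.constantCoeff_eq_zero_of_eq_X_pow_mul 0 (hperm j) (hA j))]
    exact pow_ne_zero _ hγ

/-- **THE CURVE MOVE `V(y,u₂)` of the count-game bridge** (letters swapped): successors are unit × monomial or represent `A′ = A / u₂^{d−·}` with
boundary `{u₂} ∪ {u₁ : u₁ ∈ N}`. -/
theorem curveMoveOne_of_represents {d : ℕ} {A A' : Fin d → MvPowerSeries (Fin 2) k} (hA : PolyDescent.IsPosT d A)
    (hperm : ∀ j, A j = X 1 ^ (d - (j : ℕ)) * A' j) {b : MvPowerSeries (Fin 3) k} {N : Finset (Fin 2)} (hrep : Represents b d A N) :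
    ∃ Φ : Fin 3 → MvPowerSeries (Fin 3) k,
      IsCountMove (m := 2) Φ (fun l : Fin (2 + 1) => if l = Fin.castSucc 1 ∨ l = Fin.last 2 then (1 : ℕ) else 0) ∧
      MoveClause (m := 2) b Φ (fun l : Fin (2 + 1) => if l = Fin.castSucc 1 ∨ l = Fin.last 2 then (1 : ℕ) else 0)
        (fun b' => IsStdNC b' ∨ Represents b' d A' (insert 1 (N.filter fun l => l = 0))) := by
  classical
  obtain ⟨Θ, U, hΘ0, hdet, hU, hb⟩ := hrep
  refine ⟨Θ, ⟨hΘ0, hdet, curveWt_le_one 1, Fin.last 2, by simp⟩, fun c hcv hc Aexp G hfac hG => ?_⟩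
  have hcl : ∀ l : Fin 2, l ≠ 1 → c (Fin.castSucc l) = 0 := fun l hl => hcv _ (curveWt_castSucc_ne hl)
  rw [chart_eq_cruxChart _ c hcv] at hfac
  have hGeq := curve_factorisation 1 hperm hU hb c hcl hfac hG
  subst hGeq
  have hUc : constantCoeff (subst (CobordantGame.cruxChart k
      (fun l : Fin (2 + 1) => if l = Fin.castSucc 1 ∨ l = Fin.last 2 then (1 : ℕ) else 0) c) U) ≠ 0 := by
    rw [constantCoeff_subst_of_constantCoeff_zero _ (constantCoeff_cruxChart (k := k) _ _)]; exact hU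
  by_cases hγ : c (Fin.last 2) = 0
  · have hc1 : c 1 ≠ 0 := castSucc_ne_zero_of_curvePoint 1 hc hγ hcl
    refine ⟨1, hc1, Or.inr ?_⟩
    rw [hγ]
    exact represents_curveSucc_one A' N c (hcl 0 (by decide)) hc1 hUc
  · refine ⟨Fin.last 2, hγ, Or.inl (isStdNC_succ_last N c hUc ?_)⟩
    rw [gCurve, MonicCurveBlowup.constantCoeff_g₀ (m := 2) 1 _ _ _ (fun j => by
      rw [constantCoeff_gCoef]; exact MonicCurveBlowup.constantCoeff_eq_zero_of_eq_X_pow_mul 1 (hperm j) (hA j))]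
    exact pow_ne_zero _ hγ

end NCPoly

end Summit.ResolutionOfSingularities.ResolutionOfSingularities.Theorems

end
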